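import Mathlib
import HarnessLib
import Literature.MathematicalPhysics.QuantumLattice.HubbardFreeCovariance

/-!
# Route `KLProgramme` — edge facts for the pair masses ACROSS TRANSFERS, XVII: COUNTING COLUMNS in an angular window —
# `0 ≤ u < w ≤ π ⟹ (w − u)·L/(2π) − 1 ≤ #{a ∈ ℤ/Lℤ : cos w < cos(2πa/L) < cos u}` (the `#C` of the crossing-column criterion, `…CrossingColumns`)

Cell gate-hubbard-kl, seat hubbard-kl-k3c1-p1 (g21; child-1 lineage).  Row 30 exhibits the crossing columns of the frame band as `C = {a : c_lo < cos(2πa/L) < c_hi}`;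
row 29 multiplies the level-set floor by `#C`.  THIS FILE floors `#C` for an angular window: the grid angles `2πa/L`, `a = 0, …, L − 1`, in an interval `(u, w) ⊂ [0, π]`
number at least `(w − u)L/(2π) − 1` (§1: integers in a real interval; §2: transfer to `ℤ/Lℤ` through `val`), and on `[0, π]` the cosine is strictly antitone (§3), so
**`klac_card_cos_window_ge`**: `(w − u)·L/(2π) − 1 ≤ #{a : cos w < cos(2π·val a/L) < cos u}`.  E1 takes `u = arccos(min(c_hi, 1))`, `w = arccos(max(c_lo, −1))`.
Pure counting; no definitions; nothing asserts any slot, stub, K3 or SC. [folklore]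
-/

noncomputable section

namespace Summit.HubbardSuperconductivity.HubbardSuperconductivity.Theorems.KLRegimeSplit

set_option linter.dupNamespace false -- summit = problem name (single-conjunct summit), D-0017

open Real Finset

/-! ## §1 Integers in a real interval -/

/-- **Integers in an interval**: for `0 ≤ x`, the naturals `a` with `x < a < y` and `a < N` (`y ≤ N`) number at least `y − x − 1`. [folklore] -/
theorem klac_card_nat_window_ge {x y : ℝ} (hx : 0 ≤ x) {N : ℕ} (hyN : y ≤ N) :
    y - x - 1 ≤ (((range N).filter fun a : ℕ => x < (a : ℝ) ∧ (a : ℝ) < y).card : ℝ) := by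
  classical
  -- the integers `⌊x⌋ + 1, …, ⌈y⌉ − 1`
  set m := ⌊x⌋₊ + 1 with hm
  set n := ⌈y⌉₊ with hn
  have hsub : Finset.Ico m (n - 1 + 1) ⊆ (range N).filter fun a : ℕ => x < (a : ℝ) ∧ (a : ℝ) < y := by
    intro a ha
    rw [Finset.mem_Ico] at ha
    rw [mem_filter, mem_range]
    have h1 : x < a := by
      have := Nat.lt_of_floor_lt (show ⌊x⌋₊ < a by omega)
      exact this
    have h2 : (a : ℝ) < y := by
      have ha2 : a < ⌈y⌉₊ := by omega
      exact Nat.lt_ceil.1 ha2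
    refine ⟨?_, h1, h2⟩
    have : (a : ℝ) < N := h2.trans_le hyN
    exact_mod_cast this
  have hcard := Finset.card_le_card hsub
  rw [Nat.card_Ico] at hcard
  have hc : ((n - 1 + 1 - m : ℕ) : ℝ) ≤ (((range N).filter fun a : ℕ => x < (a : ℝ) ∧ (a : ℝ) < y).card : ℝ) := by exact_mod_cast hcard
  -- `n − m ≥ y − x − 1` as reals
  have hfloor : (⌊x⌋₊ : ℝ) ≤ x := Nat.floor_le hx
  have hceil : y ≤ (⌈y⌉₊ : ℝ) := Nat.le_ceil y
  have hnm : y - x - 1 ≤ ((n - 1 + 1 - m : ℕ) : ℝ) := by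
    have h1 : ((n : ℝ) - m) ≤ ((n - 1 + 1 - m : ℕ) : ℝ) := by
      have : (n : ℤ) - m ≤ ((n - 1 + 1 - m : ℕ) : ℤ) := by omega
      exact_mod_cast this
    have h2 : y - x - 1 ≤ (n : ℝ) - m := by
      simp only [hm, hn]; push_cast; linarith
    exact h2.trans h1
  exact hnm.trans hc

/-! ## §2 Transfer to `ℤ/Lℤ` and the cosine window -/

/-- **Grid angles in an angular window**: `0 ≤ u`, `w ≤ 2π` ⟹ `(w − u)·L/(2π) − 1 ≤ #{a : ℤ/Lℤ | u < 2π·val a/L < w}` (`1 ≤ L`). [folklore] -/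
theorem klac_card_angle_window_ge {L : ℕ} [NeZero L] {u w : ℝ} (hu : 0 ≤ u) (hw : w ≤ 2 * π) :
    (w - u) * L / (2 * π) - 1 ≤ (((univ : Finset (ZMod L)).filter fun a => u < 2 * π * (a.val : ℝ) / L ∧ 2 * π * (a.val : ℝ) / L < w).card : ℝ) := by
  classical
  have hL : (0 : ℝ) < L := by exact_mod_cast Nat.pos_of_ne_zero (NeZero.ne L)
  have hπ := Real.pi_pos
  -- the window in the integer label: `x = uL/(2π) < a < wL/(2π) = y ≤ L`
  set x := u * L / (2 * π) with hx
  set y := w * L / (2 * π) with hy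
  have hx0 : 0 ≤ x := by positivity
  have hyL : y ≤ (L : ℕ) := by
    rw [hy, div_le_iff₀ (by positivity)]; nlinarith
  have h1 := klac_card_nat_window_ge hx0 hyL
  -- inject `range L` into `ZMod L` by the cast (injective below `L`, `val` recovers the label)
  set S := (range L).filter fun a : ℕ => x < (a : ℝ) ∧ (a : ℝ) < y with hS
  set T := (univ : Finset (ZMod L)).filter fun a => u < 2 * π * (a.val : ℝ) / L ∧ 2 * π * (a.val : ℝ) / L < w with hT
  have hinj : Set.InjOn (fun a : ℕ => (a : ZMod L)) S := by
    intro a ha b hb h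
    have haL : a < L := mem_range.1 (mem_filter.1 (Finset.mem_coe.1 ha)).1
    have hbL : b < L := mem_range.1 (mem_filter.1 (Finset.mem_coe.1 hb)).1
    have h' := (ZMod.natCast_eq_natCast_iff' a b L).1 h
    rwa [Nat.mod_eq_of_lt haL, Nat.mod_eq_of_lt hbL] at h'
  have himg : S.image (fun a : ℕ => (a : ZMod L)) ⊆ T := by
    intro z hz
    obtain ⟨a, ha, rfl⟩ := mem_image.1 hz
    obtain ⟨haL, hxa, hay⟩ := mem_filter.1 ha
    rw [mem_range] at haL
    rw [hT, mem_filter]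
    have hval : ((a : ZMod L).val : ℝ) = a := by rw [ZMod.val_natCast, Nat.mod_eq_of_lt haL]
    refine ⟨mem_univ _, ?_, ?_⟩
    · rw [hval]; rw [hx, div_lt_iff₀ (by positivity)] at hxa; rw [lt_div_iff₀ hL]; linarith
    · rw [hval]; rw [hy, lt_div_iff₀ (by positivity)] at hay; rw [div_lt_iff₀ hL]; linarith
  have hle : S.card ≤ T.card := by
    rw [← Finset.card_image_of_injOn hinj]; exact Finset.card_le_card himg
  have hre : (w - u) * L / (2 * π) = y - x := by rw [hx, hy]; ring
  rw [hre]
  exact h1.trans (by exact_mod_cast hle)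

/-- **Columns in a cosine window**: `0 ≤ u ≤ w ≤ π` ⟹ `(w − u)·L/(2π) − 1 ≤ #{a : ℤ/Lℤ | cos w < cos(2π·val a/L) < cos u}` (cosine is strictly antitone on `[0, π]`;
the mirror arc `(2π − w, 2π − u)` would double the count). [folklore] -/
theorem klac_card_cos_window_ge {L : ℕ} [NeZero L] {u w : ℝ} (hu : 0 ≤ u) (huw : u ≤ w) (hw : w ≤ π) :
    (w - u) * L / (2 * π) - 1 ≤
      (((univ : Finset (ZMod L)).filter fun a => Real.cos w < Real.cos (2 * π * (a.val : ℝ) / L) ∧ Real.cos (2 * π * (a.val : ℝ) / L) < Real.cos u).card : ℝ) := by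
  classical
  have h1 := klac_card_angle_window_ge (L := L) hu (hw.trans (by linarith [Real.pi_pos]))
  refine h1.trans ?_
  have hsub : ((univ : Finset (ZMod L)).filter fun a => u < 2 * π * (a.val : ℝ) / L ∧ 2 * π * (a.val : ℝ) / L < w) ⊆
      (univ : Finset (ZMod L)).filter fun a => Real.cos w < Real.cos (2 * π * (a.val : ℝ) / L) ∧ Real.cos (2 * π * (a.val : ℝ) / L) < Real.cos u := by
    intro a ha
    obtain ⟨-, h1, h2⟩ := mem_filter.1 ha
    rw [mem_filter]
    refine ⟨mem_univ _, ?_, ?_⟩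
    · exact Real.cos_lt_cos_of_nonneg_of_le_pi (by linarith) hw h2
    · exact Real.cos_lt_cos_of_nonneg_of_le_pi hu (by linarith) h1
  exact_mod_cast Finset.card_le_card hsub

end Summit.HubbardSuperconductivity.HubbardSuperconductivity.Theorems.KLRegimeSplit

end
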